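import Summits.CriticalPhenomena.PercolationContinuityZ3.Theorems.PercNearOneGluingNoHeavyLowerTailThreePartitionCombBridgeConverse
import Summits.CriticalPhenomena.PercolationContinuityZ3.Theorems.SahiMasterFamilyPrincipalDomination

/-!
# `NoHeavyLowerTail` (crux stmt-CriticalPhenomena-4575), route P3 (Ahlswede–Daykin) × comb hierarchy: a SIXTH stratum —
# (M⁺-3) when a PAIRWISE INTERSECTION is a cylinder (the `P`-class), by a seven-term comb-positive identity

Support file (cell `prim-l12`, seat P3, gen 2; `--supports stmt-CriticalPhenomena-4575`).  No `sorry`, no named facts, standard axioms.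

The class.  Three increasing events `U, A, B` of a finite cube with `A ∩ B = P = {ω | a ⊆ ω}` a CYLINDER (principal up-set); `U` is
arbitrary increasing and neither `A` nor `B` need be a cylinder (seat P4's example `A = X₁(X₂ ∨ f)`, `B = X₂(X₁ ∨ g)`, `U = f`).  Seat P4
proved Sahi's `E₃(U,A,B) ≥ 0` on this class at the MEASURE level — for product measures by a fibre-local transport
(`…SahiE3PrincipalMeet.sahiE3_nonneg_of_mul_eq_cylinder`) and for every FKG weight by a cross-fibre Holley transport
(`…SahiE3PrincipalMeetFKG`).  It is none of the five comb-level strata of `…SahiCombStrata` (comparable pair, cylinder MEMBER,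
independent member, disjoint supports, a member containing the meet of the other two).

This file lifts P4's product-measure argument to the COMB level (M⁺-3): with `D = aᶜ`, `X^S := secUnion S X = {ω | ω ∪ S ∈ X}`,
`u' = μ(U^a)`, `A* = μ(A^D)`, `B* = μ(B^D)` (all probabilities under `μ = μ_p`), the EXACT IDENTITY (`sahiE_three_eq_of_inter_eq_cylinder`)

  `E₃(1_U,1_A,1_B) = u'·[μ(A^D ∩ B^D) − A*·B*] + u'·(A* − μA)(B* − μB) + μA·[μ(U^a ∩ B^D) − μ(U^a ∩ B)] + μB·[μ(U^a ∩ A^D) − μ(U^a ∩ A)]`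
  `                 + [μ(A∩B) − μA·μB]·(u' − μU) + μA·[μ(U^a ∩ B) − μ(U ∩ B)] + μB·[μ(U^a ∩ A) − μ(U ∩ A)]`

holds for every `p` (ingredients: first-slot linearity of `E₃`; `1_{U^a} = 1_U` on `P`; `μ(U^a ∩ P) = μ(U^a)μ(P)` and
`μ(U^a ∩ B^D) = μ(U^a)μ(B^D)` — `U^a` is determined by `D`, `P` and `B^D` by `a`; `A^D ∩ B^D = P`).  Every bracket is comb-positive:
two covariances of increasing events ((M⁺-2), `combPos_covFun`), and defect moments `μ(X^S ∖ X)`, `μ(Y ∩ (X^S ∖ X))` of increasing `X`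
(degree 1); multidegrees add up to `≤ 3`.  Hence

* `combPos_sahiE_three_of_inter_eq_cylinder` — **(M⁺-3) on the `P`-class**: `p ↦ E₃(μ_p; 1_U, 1_A, 1_B)` is a nonnegative combination of
  the degree-3 tensor-Bernstein basis whenever `U, A, B` are increasing and `A ∩ B` is a cylinder; the `Fin 3`-family form
  `combPos_sahiE_three_of_pairInter_eq_cylinder` (any slot free);
* `threePartNT_nonneg_of_inter_eq_cylinder` — by the bridge (`ThreePartition.threePartNT_nonneg_of_combPos`), the twisted three-partition
  functional of this seat is `≥ 0` on the `P`-class for every twist: a sixth stratum of `ThreePartitionPositivityTwisted` (★★);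
* `sahiE_three_ind_nonneg_of_inter_eq_cylinder` — the law-level statement back (a second proof of P4's product-measure theorem) and
  density-free zeros on the class (`…eq_zero_of_interior_zero…`).
-/

noncomputable section

open scoped Classical

namespace Summit.CriticalPhenomena.PercolationContinuityZ3.Theorems

namespace SahiCombPrincipalMeet

open Finset Function
open Literature.Combinatorics.Sahi2008
open Literature.Probability.LatticeModels (prodBernoulli prodBernoulli_real_inter_of_determinedBy_disjoint)
open Literature.Probability.Percolation (DeterminedBy determinedBy_iff)
open Literature.Probability.Percolation.DecisionTree (ind ind_of_mem ind_of_not_mem ind_nonneg)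
open SahiComb

variable {ι : Type} [Fintype ι]

/-! ### Set algebra of the class -/

omit [Fintype ι] in
/-- On the cylinder `{a ⊆ ω}` freezing `a` to `1` does nothing: `1_{U^a} · 1_P = 1_U · 1_P`. [this work] -/
theorem ind_secUnion_mul_ind_cylinder (a : Set ι) (U : Set (Set ι)) :
    ind (secUnion a U) * ind {ω : Set ι | a ⊆ ω} = ind U * ind {ω : Set ι | a ⊆ ω} := by
  funext ω
  simp only [Pi.mul_apply]
  by_cases hω : a ⊆ ω
  · have hU : ω ∪ a = ω := Set.union_eq_self_of_subset_right hω
    have : ω ∈ secUnion a U ↔ ω ∈ U := by rw [mem_secUnion, hU]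
    by_cases h1 : ω ∈ U
    · rw [ind_of_mem h1, ind_of_mem (this.2 h1)]
    · rw [ind_of_not_mem h1, ind_of_not_mem fun h => h1 (this.1 h)]
  · have : ω ∉ {ω : Set ι | a ⊆ ω} := hω
    rw [ind_of_not_mem this, mul_zero, mul_zero]

omit [Fintype ι] in
/-- The section of the cylinder `{a ⊆ ω}` along `aᶜ` is the cylinder itself. [this work] -/
theorem secUnion_compl_cylinder (a : Set ι) : secUnion aᶜ {ω : Set ι | a ⊆ ω} = {ω : Set ι | a ⊆ ω} := by
  ext ω
  simp only [mem_secUnion, Set.mem_setOf_eq]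
  constructor
  · intro h x hx
    have := h hx
    rcases this with h' | h'
    · exact h'
    · exact absurd hx h'
  · intro h x hx
    exact Or.inl (h hx)

omit [Fintype ι] in
/-- A set-section `X^S` is determined by the coordinates outside `S`. [this work] -/
theorem determinedBy_secUnion (S : Set ι) (X : Set (Set ι)) : DeterminedBy (secUnion S X) Sᶜ := by
  rw [determinedBy_iff]
  intro ω ω' h
  have key : ω ∪ S = ω' ∪ S := by
    ext x
    by_cases hx : x ∈ S
    · simp [hx]
    · have := Set.ext_iff.1 h x
      simp only [Set.mem_inter_iff, Set.mem_compl_iff, hx, not_false_eq_true, and_true] at this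
      simp [hx, this]
  rw [mem_secUnion, mem_secUnion, key]

/-- **Independence across complementary coordinate sets** in `ex`/`ind` form: if `X` is determined by `Sᶜ` and `Y` by `S` then
`E[1_X 1_Y] = E[1_X]·E[1_Y]` under every product weight. [folklore] -/
theorem ex_ind_inter_of_determinedBy_compl (p : ι → unitInterval) (S : Set ι) {X Y : Set (Set ι)}
    (hX : DeterminedBy X Sᶜ) (hY : DeterminedBy Y S) :
    ex (bernoulliWeight p) (ind (X ∩ Y)) = ex (bernoulliWeight p) (ind X) * ex (bernoulliWeight p) (ind Y) := by
  rw [ex_bernoulliWeight_ind, ex_bernoulliWeight_ind, ex_bernoulliWeight_ind]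
  have hdisj : Disjoint Sᶜ.toFinset S.toFinset := by
    rw [Finset.disjoint_left]
    intro x hx hx'
    rw [Set.mem_toFinset] at hx hx'
    exact hx hx'
  have hX' : DeterminedBy X (↑(Sᶜ.toFinset) : Set ι) := by rwa [Set.coe_toFinset]
  have hY' : DeterminedBy Y (↑(S.toFinset) : Set ι) := by rwa [Set.coe_toFinset]
  exact prodBernoulli_real_inter_of_determinedBy_disjoint p hdisj hX' hY' MeasurableSet.of_discrete
    MeasurableSet.of_discrete

/-- Freezing on the cylinder: `E[1_P · 1_{U^a}] = E[1_P]·E[1_{U^a}]` for `P = {a ⊆ ω}`. [this work] -/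
theorem ex_ind_cylinder_inter_secUnion (p : ι → unitInterval) (a : Set ι) (U : Set (Set ι)) :
    ex (bernoulliWeight p) (ind (secUnion a U ∩ {ω : Set ι | a ⊆ ω})) =
      ex (bernoulliWeight p) (ind (secUnion a U)) * ex (bernoulliWeight p) (ind {ω : Set ι | a ⊆ ω}) := by
  have h := ex_ind_inter_of_determinedBy_compl p a (determinedBy_secUnion a U) (determinedBy_cylinder a)
  exact h

/-! ### The seven-term identity -/

omit [Fintype ι] in
/-- `1_X · 1_Y = 1_{X ∩ Y}` (plumbing, local copy of the pointwise statement). [folklore] -/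
theorem ind_mul_apply (X Y : Set (Set ι)) (ω : Set ι) : ind X ω * ind Y ω = ind (X ∩ Y) ω :=
  (Literature.Probability.Percolation.BHK2006.ind_inter X Y ω).symm

/-- **The identity.**  For events `U, A, B` with `A ∩ B = {a ⊆ ω}` (no monotonicity needed for the identity itself) and every `p`:
`E₃(1_U,1_A,1_B) = u'·Cov(A^D,B^D) + u'(A*−μA)(B*−μB) + μA·[μ(U^a∩B^D) − μ(U^a∩B)] + μB·[μ(U^a∩A^D) − μ(U^a∩A)]
 + Cov(A,B)·(u'−μU) + μA·[μ(U^a∩B) − μ(U∩B)] + μB·[μ(U^a∩A) − μ(U∩A)]`, `D = aᶜ`. [this work] -/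
theorem sahiE_three_eq_of_inter_eq_cylinder (p : ι → unitInterval) (a : Set ι) {U A B : Set (Set ι)}
    (hP : A ∩ B = {ω : Set ι | a ⊆ ω}) :
    sahiE (bernoulliWeight p) 3 ![ind U, ind A, ind B] =
      ex (bernoulliWeight p) (ind (secUnion a U)) * covFun (secUnion aᶜ A) (secUnion aᶜ B) p
      + ex (bernoulliWeight p) (ind (secUnion a U)) *
          ((ex (bernoulliWeight p) (ind (secUnion aᶜ A)) - ex (bernoulliWeight p) (ind A)) *
            (ex (bernoulliWeight p) (ind (secUnion aᶜ B)) - ex (bernoulliWeight p) (ind B)))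
      + ex (bernoulliWeight p) (ind A) *
          (ex (bernoulliWeight p) (ind (secUnion a U ∩ secUnion aᶜ B)) - ex (bernoulliWeight p) (ind (secUnion a U ∩ B)))
      + ex (bernoulliWeight p) (ind B) *
          (ex (bernoulliWeight p) (ind (secUnion a U ∩ secUnion aᶜ A)) - ex (bernoulliWeight p) (ind (secUnion a U ∩ A)))
      + covFun A B p * (ex (bernoulliWeight p) (ind (secUnion a U)) - ex (bernoulliWeight p) (ind U))
      + ex (bernoulliWeight p) (ind A) *
          (ex (bernoulliWeight p) (ind (secUnion a U ∩ B)) - ex (bernoulliWeight p) (ind (U ∩ B)))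
      + ex (bernoulliWeight p) (ind B) *
          (ex (bernoulliWeight p) (ind (secUnion a U ∩ A)) - ex (bernoulliWeight p) (ind (U ∩ A))) := by
  set μ := bernoulliWeight p with hμ
  -- the four structural facts
  have h1 : ex μ (ind (secUnion aᶜ A ∩ secUnion aᶜ B)) = ex μ (ind (A ∩ B)) := by
    rw [← secUnion_inter, hP, secUnion_compl_cylinder]
  have h2 : ex μ (ind (secUnion a U ∩ secUnion aᶜ B)) = ex μ (ind (secUnion a U)) * ex μ (ind (secUnion aᶜ B)) :=
    ex_ind_inter_of_determinedBy_compl p a (determinedBy_secUnion a U)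
      (by simpa only [compl_compl] using determinedBy_secUnion aᶜ B)
  have h3 : ex μ (ind (secUnion a U ∩ secUnion aᶜ A)) = ex μ (ind (secUnion a U)) * ex μ (ind (secUnion aᶜ A)) :=
    ex_ind_inter_of_determinedBy_compl p a (determinedBy_secUnion a U)
      (by simpa only [compl_compl] using determinedBy_secUnion aᶜ A)
  have h4 : ex μ (ind (U ∩ (A ∩ B))) = ex μ (ind (secUnion a U)) * ex μ (ind (A ∩ B)) := by
    rw [hP, ← ex_ind_cylinder_inter_secUnion p a U]
    refine congrArg _ (funext fun ω => ?_)
    rw [← ind_mul_apply, ← ind_mul_apply]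
    have := congrFun (ind_secUnion_mul_ind_cylinder a U) ω
    simp only [Pi.mul_apply] at this
    rw [this]
  -- expand `E₃`
  have hprod3 : ind U * ind A * ind B = ind (U ∩ (A ∩ B)) := by
    funext ω; simp only [Pi.mul_apply]; rw [mul_assoc, ind_mul_apply, ind_mul_apply]
  have hprod : ∀ X Y : Set (Set ι), ind X * ind Y = ind (X ∩ Y) := fun X Y => funext fun ω => ind_mul_apply X Y ω
  rw [sahiE_three, hprod3, hprod, hprod, hprod]
  simp only [covFun]
  rw [h1]
  linear_combination (2 : ℝ) * h4 - ex μ (ind A) * h2 - ex μ (ind B) * h3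

/-! ### Comb positivity of the seven terms -/

/-- A restricted defect moment `μ(Y ∩ X^S) − μ(Y ∩ X) = μ(Y ∩ (X^S ∖ X))` of an increasing `X` is comb-positive at multidegree `1`.
[this work] -/
theorem combPos_ex_inter_secUnion_sub (S : Set ι) (Y : Set (Set ι)) {X : Set (Set ι)} (hX : IsUpperSet X) :
    CombPos (fun _ : ι => 1)
      (fun p => ex (bernoulliWeight p) (ind (Y ∩ secUnion S X)) - ex (bernoulliWeight p) (ind (Y ∩ X))) := by
  have hle : ∀ ω, ind (Y ∩ X) ω ≤ ind (Y ∩ secUnion S X) ω := fun ω => by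
    by_cases h0 : ω ∈ Y ∩ X
    · rw [ind_of_mem h0, ind_of_mem (Set.mem_inter h0.1 (subset_secUnion S hX h0.2))]
    · rw [ind_of_not_mem h0]; exact ind_nonneg _ ω
  refine (combPos_ex (h := fun ω => ind (Y ∩ secUnion S X) ω - ind (Y ∩ X) ω) fun ω => sub_nonneg.2 (hle ω)).congr
    fun p => ?_
  simp only [ex_def, mul_sub, sum_sub_distrib]

/-- **(M⁺-3) on the `P`-class (head form)**: `U, A, B` increasing with `A ∩ B = {a ⊆ ω}` a cylinder ⇒ `p ↦ E₃(μ_p; 1_U,1_A,1_B)` is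
comb-positive at multidegree `3`. [this work] -/
theorem combPos_sahiE_three_of_inter_eq_cylinder (a : Set ι) {U A B : Set (Set ι)} (hU : IsUpperSet U) (hA : IsUpperSet A)
    (hB : IsUpperSet B) (hP : A ∩ B = {ω : Set ι | a ⊆ ω}) :
    CombPos (fun _ : ι => 3) (fun p => sahiE (bernoulliWeight p) 3 ![ind U, ind A, ind B]) := by
  have d11 : (fun _ : ι => (1 : ℕ)) + (fun _ : ι => 1) = fun _ : ι => 2 := by funext e; simp
  have d12 : (fun _ : ι => (1 : ℕ)) + (fun _ : ι => 2) = fun _ : ι => 3 := by funext e; simp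
  have d21 : (fun _ : ι => (2 : ℕ)) + (fun _ : ι => 1) = fun _ : ι => 3 := by funext e; simp
  have d23 : (fun _ : ι => (2 : ℕ)) ≤ (fun _ : ι => 3) := fun e => by norm_num
  have hu' : CombPos (fun _ : ι => 1) (fun p => ex (bernoulliWeight p) (ind (secUnion a U))) := combPos_ex_ind _
  have hA1 : CombPos (fun _ : ι => 1) (fun p => ex (bernoulliWeight p) (ind A)) := combPos_ex_ind _
  have hB1 : CombPos (fun _ : ι => 1) (fun p => ex (bernoulliWeight p) (ind B)) := combPos_ex_ind _
  -- T1
  have T1 : CombPos (fun _ : ι => 3)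
      (fun p => ex (bernoulliWeight p) (ind (secUnion a U)) * covFun (secUnion aᶜ A) (secUnion aᶜ B) p) :=
    hu'.mul_of_eq (combPos_covFun _ _ (isUpperSet_secUnion _ hA) (isUpperSet_secUnion _ hB)) d12
  -- T2
  have T2 : CombPos (fun _ : ι => 3)
      (fun p => ex (bernoulliWeight p) (ind (secUnion a U)) *
        ((ex (bernoulliWeight p) (ind (secUnion aᶜ A)) - ex (bernoulliWeight p) (ind A)) *
          (ex (bernoulliWeight p) (ind (secUnion aᶜ B)) - ex (bernoulliWeight p) (ind B)))) :=
    hu'.mul_of_eq ((combPos_ex_secUnion_sub aᶜ hA).mul_of_eq (combPos_ex_secUnion_sub aᶜ hB) d11) d12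
  -- T3, T4
  have T3 : CombPos (fun _ : ι => 3)
      (fun p => ex (bernoulliWeight p) (ind A) *
        (ex (bernoulliWeight p) (ind (secUnion a U ∩ secUnion aᶜ B)) - ex (bernoulliWeight p) (ind (secUnion a U ∩ B)))) :=
    (hA1.mul_of_eq (combPos_ex_inter_secUnion_sub aᶜ (secUnion a U) hB) d11).mono d23
  have T4 : CombPos (fun _ : ι => 3)
      (fun p => ex (bernoulliWeight p) (ind B) *
        (ex (bernoulliWeight p) (ind (secUnion a U ∩ secUnion aᶜ A)) - ex (bernoulliWeight p) (ind (secUnion a U ∩ A)))) :=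
    (hB1.mul_of_eq (combPos_ex_inter_secUnion_sub aᶜ (secUnion a U) hA) d11).mono d23
  -- T5
  have T5 : CombPos (fun _ : ι => 3)
      (fun p => covFun A B p * (ex (bernoulliWeight p) (ind (secUnion a U)) - ex (bernoulliWeight p) (ind U))) :=
    (combPos_covFun A B hA hB).mul_of_eq (combPos_ex_secUnion_sub a hU) d21
  -- T6, T7: `U ∩ X ⊆ U^a ∩ X`
  have T6 : CombPos (fun _ : ι => 3)
      (fun p => ex (bernoulliWeight p) (ind A) *
        (ex (bernoulliWeight p) (ind (secUnion a U ∩ B)) - ex (bernoulliWeight p) (ind (U ∩ B)))) := by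
    have h := combPos_ex_inter_secUnion_sub a B hU
    have h' : CombPos (fun _ : ι => 1)
        (fun p => ex (bernoulliWeight p) (ind (secUnion a U ∩ B)) - ex (bernoulliWeight p) (ind (U ∩ B))) :=
      h.congr fun p => by rw [Set.inter_comm (secUnion a U) B, Set.inter_comm U B]
    exact (hA1.mul_of_eq h' d11).mono d23
  have T7 : CombPos (fun _ : ι => 3)
      (fun p => ex (bernoulliWeight p) (ind B) *
        (ex (bernoulliWeight p) (ind (secUnion a U ∩ A)) - ex (bernoulliWeight p) (ind (U ∩ A)))) := by
    have h := combPos_ex_inter_secUnion_sub a A hU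
    have h' : CombPos (fun _ : ι => 1)
        (fun p => ex (bernoulliWeight p) (ind (secUnion a U ∩ A)) - ex (bernoulliWeight p) (ind (U ∩ A))) :=
      h.congr fun p => by rw [Set.inter_comm (secUnion a U) A, Set.inter_comm U A]
    exact (hB1.mul_of_eq h' d11).mono d23
  exact ((((((T1.add T2).add T3).add T4).add T5).add T6).add T7).congr fun p =>
    sahiE_three_eq_of_inter_eq_cylinder p a hP

/-- **(M⁺-3) on the `P`-class, any free slot**: for three increasing events `U₀, U₁, U₂` such that the two events other than `U m`
intersect in a cylinder `{a ⊆ ω}`, `E₃(μ_p; 1_{U₀},1_{U₁},1_{U₂})` is comb-positive at multidegree `3`. [this work] -/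
theorem combPos_sahiE_three_of_pairInter_eq_cylinder (U : Fin 3 → Set (Set ι)) (hU : ∀ j, IsUpperSet (U j)) (m : Fin 3)
    (a : Set ι) (ha : (⋂ j, U (m.succAbove j)) = {ω : Set ι | a ⊆ ω}) :
    CombPos (fun _ : ι => 3) (fun p => sahiE (bernoulliWeight p) 3 (fun j => ind (U j))) := by
  obtain ⟨τ, hτ⟩ := exists_perm_forall_sahiE_ind_eq_cons U m
  have hfam : (Matrix.vecCons (ind (U m)) fun j => ind (U (m.succAbove (τ j)))) =
      ![ind (U m), ind (U (m.succAbove (τ 0))), ind (U (m.succAbove (τ 1)))] := by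
    congr 1
    funext j
    fin_cases j <;> rfl
  have hinter : U (m.succAbove (τ 0)) ∩ U (m.succAbove (τ 1)) = {ω : Set ι | a ⊆ ω} := by
    rw [← ha]
    ext ω
    simp only [Set.mem_inter_iff, Set.mem_iInter]
    constructor
    · rintro ⟨h0, h1⟩ j
      obtain ⟨i, rfl⟩ := τ.surjective j
      fin_cases i
      · exact h0
      · exact h1
    · intro h; exact ⟨h _, h _⟩
  exact (combPos_sahiE_three_of_inter_eq_cylinder a (hU m) (hU _) (hU _) hinter).congr fun p => by
    rw [hτ (bernoulliWeight p), hfam]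

/-- **Three-partition positivity on the `P`-class, every twist** (through the bridge `ThreePartition.threePartNT_nonneg_of_combPos`):
`threePartNT τ U A B ≥ 0` whenever `U, A, B` are increasing and `A ∩ B` is a cylinder. [this work] -/
theorem threePartNT_nonneg_of_inter_eq_cylinder (τ : Set ι) (a : Set ι) {U A B : Set (Set ι)} (hU : IsUpperSet U)
    (hA : IsUpperSet A) (hB : IsUpperSet B) (hP : A ∩ B = {ω : Set ι | a ⊆ ω}) :
    0 ≤ ThreePartition.threePartNT τ U A B :=
  ThreePartition.threePartNT_nonneg_of_combPos τ (combPos_sahiE_three_of_inter_eq_cylinder a hU hA hB hP)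

/-- Law level back (second proof of seat P4's product-measure theorem `…SahiE3PrincipalMeet`): `E₃(μ_p; 1_U,1_A,1_B) ≥ 0` on the
`P`-class for every `p ∈ [0,1]^ι`. [this work] -/
theorem sahiE_three_ind_nonneg_of_inter_eq_cylinder (p : ι → unitInterval) (a : Set ι) {U A B : Set (Set ι)} (hU : IsUpperSet U)
    (hA : IsUpperSet A) (hB : IsUpperSet B) (hP : A ∩ B = {ω : Set ι | a ⊆ ω}) :
    0 ≤ sahiE (bernoulliWeight p) 3 ![ind U, ind A, ind B] :=
  (combPos_sahiE_three_of_inter_eq_cylinder a hU hA hB hP).nonneg p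

/-- Density-free zeros on the `P`-class: a zero of `E₃` at one interior `q` forces `E₃ ≡ 0` on the closed cube. [this work] -/
theorem sahiE_three_ind_eq_zero_of_interior_zero_of_inter_eq_cylinder (a : Set ι) {U A B : Set (Set ι)} (hU : IsUpperSet U)
    (hA : IsUpperSet A) (hB : IsUpperSet B) (hP : A ∩ B = {ω : Set ι | a ⊆ ω}) {q : ι → unitInterval}
    (hq : ∀ e, (q e : ℝ) ∈ Set.Ioo (0 : ℝ) 1) (h0 : sahiE (bernoulliWeight q) 3 ![ind U, ind A, ind B] = 0)
    (p : ι → unitInterval) : sahiE (bernoulliWeight p) 3 ![ind U, ind A, ind B] = 0 :=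
  (combPos_sahiE_three_of_inter_eq_cylinder a hU hA hB hP).eq_zero_of_interior hq h0 p

end SahiCombPrincipalMeet

end Summit.CriticalPhenomena.PercolationContinuityZ3.Theorems
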